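import Literature.NumberTheory.ComplexMultiplication.TaniyamaElement
import Literature.NumberTheory.NumberFields.IdelicArtinMapAutomorphism
import HarnessLib

/-!
# The Taniyama element under an automorphism of the CM field: Milne's Proposition 4.8 (b)
# `f_{Φ(τ⁻¹|E)}(σ) = τ f_Φ(σ)` for `τE = E`  (Milne, *The fundamental theorem of complex multiplication*, §4.2)

Topic `NumberTheory/ComplexMultiplication`; namespace `Literature.NumberTheory.ComplexMultiplication`.  Lane
`lit-hodgefound` (Track 2, Layer A3 skeleton seat `skel-3`, row A3-G47 FILE 2 of 2; FILE 1
`…/NumberFields/IdelicArtinMapAutomorphism` = «`art_E(τf) = τ art_E(f) τ⁻¹`» without a Galois hypothesis; rows A3-G45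
(`…/TateHalfTransfer`, `…/TateHalfTransferCM`, `…/TaniyamaElement`: `F_Φ`, `f_Φ`, Prop. 4.6, Prop. 4.8 (a), (c)) and
A3-G46 (Prop. 4.9)).  Definitions with bodies (`HalfTransfer.translateType`, `finiteIdeleGal`, `finiteClassGal`) and
theorems, all proved; no named fact, no instance (D-0026, net debt 0).

## The print, verbatim

J. S. Milne, *The fundamental theorem of complex multiplication*, arXiv:0705.3446 [Milne2007FundamentalCM], §4.2 (held
`paper:arxiv-0705.3446` p0020 L18–L31):

> «PROPOSITION 4.8. The maps `f_Φ : Aut(ℂ) → 𝔸^×_{f,E}/E^×` have the following properties: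
> (a) `f_Φ(στ) = f_{τΦ}(σ)·f_Φ(τ)`; (b) `f_{Φ(τ⁻¹|E)}(σ) = τf_Φ(σ)` if `τE = E`; (c) `f_Φ(ι) = 1`.
> PROOF. Let `f = f_{τΦ}(σ)·f_Φ(τ)`. Then `art_E(f) = F_{τΦ}(σ)·F_Φ(τ) = ∏_{φ∈Φ} w_{στφ}⁻¹·σw_{τφ}·w_{τφ}⁻¹·τw_φ = F_Φ(στ)`
> and `f·ιf = χ(σ)χ(τ)E^× = χ(στ)E^×`. Thus `f` satisfies the conditions that determine `f_Φ(στ)`. This proves (a), and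
> (b) and (c) can be proved similarly.»

with the definitions of §4.2 (p0019 L141–L152): «`F_Φ(σ) = ∏_{φ∈Φ} w_{σφ}⁻¹ σ w_φ mod Aut(ℂ/E^ab)` where the `w_ρ` are
elements of `Aut(ℂ)` such that `w_ρ|E = ρ`, `w_{ιρ} = ιw_ρ`» and Prop. 4.6 «there is a unique `f_Φ(σ) ∈ 𝔸^×_{f,E}/E^×`
such that (a) `art_E(f_Φ(σ)) = F_Φ(σ)`; (b) `f_Φ(σ)·ιf_Φ(σ) = χ(σ)E^×`».

## «(b) can be proved similarly» — the proof written out (and formalised here)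

In the tree's `Γ_ℚ`-parametrisation of rows A3-G45/46 (C. Blake, arXiv:1606.03320 §1 [Blake2016PlecticTaniyama]):
`K` a CM field, `e : K → ℚ̄` the fixed embedding (`absEmbedding ℚ K`), `H = res(Γ_K) ≤ Γ_ℚ` its stabiliser,
`X = Γ_ℚ ⧸ H = Hom(K, ℚ̄)` (`gH ↦ g ∘ e`), `c ∈ Γ_ℚ` a complex conjugation, `Ψ ⊆ X` a CM type (`IsCMTypeWith c Ψ`),
`F_Ψ = tateHalfTransfer K c Ψ`, `f_Ψ = taniyamaElement K c Ψ`.  Milne's hypothesis «`τE = E`» reads: `τ ∈ Γ_ℚ` maps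
`e(K)` onto itself, i.e. `τ • e x = e (α x)` for an automorphism `α ∈ Aut(K)` (Milne's `τ|E`); equivalently `τ`
NORMALISES `H`.  Then Milne's `Φ(τ⁻¹|E) = {φ ∘ α⁻¹}` is, on `X`, the RIGHT TRANSLATE `Ψτ⁻¹ = {gτ⁻¹H : gH ∈ Ψ}`
(`(g τ⁻¹) ∘ e = g ∘ e ∘ α⁻¹`), and «`τ f`» is the componentwise Galois action `α • f` on `𝔸^×_{K,f}/K^×`.
* `F`: if `w` is a symmetric system of representatives (`w(q)·H = q`, `w(cq) = c w(q)`) then so is `w′(q) = w(qτ⁻¹)·τ`,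
  and `w′(σq)⁻¹ σ w′(q) = τ⁻¹·(w(σqτ⁻¹)⁻¹ σ w(qτ⁻¹))·τ`; reindexing the product over `Ψτ⁻¹` by `q ↦ qτ⁻¹` gives
  **`F_{Ψτ⁻¹}(σ) = τ F_Ψ(σ) τ⁻¹ = θ_τ^ab(F_Ψ(σ))`** in `Γ_K^ab` (Lemma 4.4 absorbs the change of section) — §1 (group
  theory, for any equivariant injection `e` of a `G`-set with `e(τx₀) = x₀`) and §3.
* `art`: `art_K(τf) = θ_τ^ab(art_K(f))` — FILE 1 (`absGaloisConjAb_ideleArtinMap_rat`), Neukirch IV (5.8) in the limit;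
  so `[(1, α • f), K] = θ_τ^ab([(1, f), K]) = θ_τ^ab(F_Ψ(σ)⁻¹) = F_{Ψτ⁻¹}(σ)⁻¹` — Milne's condition (a) for `Ψτ⁻¹`.
* `ι` and `χ`: every automorphism of a CM field commutes with `ι_K`, so `(α•f)·ι_K(α•f) = α•(f·ι_K f) = α • χ(σ)K^× =
  χ(σ)K^×` (`χ(σ) ∈ 𝕀_ℚ` is fixed by `Aut(K)`) — Milne's condition (b) for `Ψτ⁻¹` (§4).
* Prop. 4.6's uniqueness (`eq_taniyamaElement`) gives **`f_{Ψτ⁻¹}(σ) = α • f_Ψ(σ)`** (§5), i.e. (b).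

## What is formalised

* §1 (group theory, on row A3-G45 FILE 1) `IsSymmSection.comp_mul`, `halfTransferWith_image_eq`,
  **`halfTransfer_image_eq`**: `F_{e(Φ)}^{ϕ} = F_Φ^{ϕ′}` for `ϕ′ = ϕ ∘ Inn(τ)` and an equivariant injection `e` with
  `e(τ • x₀) = x₀`; for `X = G ⧸ H`: **`HalfTransfer.translateType τ Φ = Φτ⁻¹`** (for `τ ∈ N_G(H)` the action of
  `op τ⁻¹ ∈ N_G(H)ᵒᵖ`, Mathlib `MulAction.right_quotientAction`) and `halfTransfer_translateType`.
* §2 `τ` normalises `res(Γ_K)` iff-style facts; `embOfCoset K j (qτ⁻¹) = embOfCoset K j q ∘ α⁻¹`; **the dictionary with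
  complex CM types**: `translateType τ (embOfCoset⁻¹ Φ) = embOfCoset⁻¹ Φ′` whenever `s ∈ Φ′ ↔ s ∘ α ∈ Φ` — the tree's
  «`σΦ = {s | s ∘ σ ∈ Φ}`» (`PicardCM.CMCode.cmTypeMap α Φ`), Milne's `Φ(τ⁻¹|E)` = Deligne's `τΦ`.
* §3 **`tateHalfTransfer_translateType`: `F_{Ψτ⁻¹}(σ) = θ_τ^ab (F_Ψ(σ))`.**
* §4 `finiteIdeleGal K α`, `finiteClassGal K α` — `Aut(K)` on `(𝔸_{K,f})ˣ` and on `𝔸^×_{K,f}/K^×`; `ι_K` is the case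
  `α = complexConjRat K` (`finiteIdeleConjGal_eq_finiteIdeleGal`); `α ∘ ι_K = ι_K ∘ α`; `α • χ(σ) = χ(σ)`;
  `θ_τ^ab [(1, y), K] = [(1, α • y), K]` (FILE 1).
* §5 **PROPOSITION 4.8 (b)** `taniyamaElement_translateType`: `f_{Ψτ⁻¹}(σ) = α • f_Ψ(σ)`; representatives form; the
  complex-CM-type form (`Φ′ = Φ(τ⁻¹|E)`); the Galois case (`K/ℚ` Galois: every `τ ∈ Γ_ℚ`, `α = τ̄`); `τ ∈ res(Γ_K)`
  changes nothing.

NOT HERE: Theorems 4.1/4.2 (abelian varieties; Layer B); Langlands' Weil-group definition of `f_Φ` (Remark 4.7); the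
Taniyama group; Milne's `Aut(ℂ)`-parametrisation (`σ, τ ∈ Γ_ℚ` here, as in rows A3-G45/46).

## References

* J. S. Milne, *The fundamental theorem of complex multiplication*, arXiv:0705.3446 (2007), §4.2 Prop. 4.6, Prop. 4.8,
  Lemma 4.4. [Milne2007FundamentalCM]
* C. Blake, *A plectic Taniyama group*, arXiv:1606.03320 (2016), §1. [Blake2016PlecticTaniyama]
* J. Neukirch, *Algebraic Number Theory*, Springer 1999, Ch. IV §5 (5.8). [NeukirchANT1999]
* P. Deligne (notes by J. S. Milne), *Hodge cycles on abelian varieties*, LNM 900 (1982), §5 («`A_{σΦ}`»).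
  [Deligne1982HodgeCycles]

## Provenance

Lane `lit-hodgefound`, seat `literature-prover-lit-hodgefound-skel-3-g31-0` (row A3-G47, FILE 2 of 2).
-/

noncomputable section

open scoped Pointwise
open Field NumberField IsDedekindDomain

namespace Literature.NumberTheory.ComplexMultiplication

open Literature.NumberTheory.GaloisRepresentations Literature.NumberTheory.NumberFields
open Literature.AlgebraicGeometry.Motives (CMType)
open HalfTransfer

/-! ### §1. Group theory: the half transfer of a translated CM type -/

section GroupTheory

variable {G : Type*} [Group G] {X : Type*} [MulAction G X] {A : Type*} [CommGroup A]

/-- The image of a CM type under an equivariant bijection of `X` is a CM type («`σ` permutes the unordered pairs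
`{φ, ιφ}`»). [cite: Milne2007FundamentalCM, §4.2 Lemma 4.4 (proof), Prop. 4.8 (b)] -/
theorem IsCMTypeWith.image_of_equivariant {ι : G} {Φ : Set X} (h : IsCMTypeWith ι Φ) {e : X → X}
    (he : ∀ (g : G) (x : X), e (g • x) = g • e x) (hbij : Function.Bijective e) : IsCMTypeWith ι (e '' Φ) where
  mem_iff y := by
    obtain ⟨x, rfl⟩ := hbij.2 y
    rw [hbij.1.mem_set_image, ← he, hbij.1.mem_set_image]
    exact h.mem_iff x
  comm := h.comm
  invol := h.invol

namespace HalfTransfer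

variable {ι : G} {x₀ : X} {w : X → G}

/-- **Transport of a symmetric system of representatives**: if `w` is one (`w(x)·x₀ = x`, `w(ιx) = ι w(x)`) and `e` is
an equivariant injection of `X` with `e(τ • x₀) = x₀`, then `w′(x) = w(e x)·τ` is again one — for `e = (· τ⁻¹)` on
`Hom(E, ℚ̄)` these are representatives adapted to `Φ(τ⁻¹|E)` («`w_ρ|E = ρ`, `w_{ιρ} = ιw_ρ`»).
[cite: Milne2007FundamentalCM, §4.2 (definition of F_Φ), Prop. 4.8 (b)] -/
theorem IsSymmSection.comp_mul (hw : IsSymmSection ι x₀ w) {e : X → X} {τ : G}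
    (he : ∀ (g : G) (x : X), e (g • x) = g • e x) (hinj : Function.Injective e) (heτ : e (τ • x₀) = x₀) :
    IsSymmSection ι x₀ (fun x => w (e x) * τ) where
  smul_base x := hinj (by rw [mul_smul, he, heτ, hw.smul_base])
  apply_smul x := by rw [he, hw.apply_smul, mul_assoc]

end HalfTransfer

variable {H : Subgroup G} {x₀ : X} (ϕ : H →* A) (hH : ∀ g : G, g ∈ H ↔ g • x₀ = x₀) {ι : G} {w : X → G}

/-- The factors for the transported section: `w′(σx)⁻¹ σ w′(x) = τ⁻¹ · (w(σ·e x)⁻¹ σ w(e x)) · τ`.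
[cite: Milne2007FundamentalCM, §4.2 Prop. 4.8 (proof)] -/
theorem coe_halfTransferFactor_comp_mul (hw : IsSymmSection ι x₀ w) {e : X → X} {τ : G}
    (he : ∀ (g : G) (x : X), e (g • x) = g • e x) (hinj : Function.Injective e) (heτ : e (τ • x₀) = x₀)
    (σ : G) (x : X) :
    (halfTransferFactor hH (hw.comp_mul he hinj heτ).smul_base σ x : G) =
      τ⁻¹ * (halfTransferFactor hH hw.smul_base σ (e x) : G) * τ := by
  simp only [coe_halfTransferFactor]
  rw [he]
  group

/-- **`F_{e(Φ)}^{ϕ, w}(σ) = F_Φ^{ϕ′, w′}(σ)` for `ϕ′(h) = ϕ(τ h τ⁻¹)`**: reindex the product over `e(Φ)` by `e` and use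
`coe_halfTransferFactor_comp_mul` — the computation behind «(b) can be proved similarly».
[cite: Milne2007FundamentalCM, §4.2 Prop. 4.8 (b)] -/
theorem halfTransferWith_image_eq (hw : IsSymmSection ι x₀ w) {e : X → X} {τ : G}
    (he : ∀ (g : G) (x : X), e (g • x) = g • e x) (hinj : Function.Injective e) (heτ : e (τ • x₀) = x₀)
    (Φ : Set X) (ϕ' : H →* A)
    (hϕ' : ∀ (h : H) (hmem : τ * (h : G) * τ⁻¹ ∈ H), ϕ ⟨τ * h * τ⁻¹, hmem⟩ = ϕ' h) (σ : G) :
    halfTransferWith ϕ hH hw.smul_base (e '' Φ) σ =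
      halfTransferWith ϕ' hH (hw.comp_mul he hinj heτ).smul_base Φ σ := by
  rw [halfTransferWith_def, halfTransferWith_def, finprod_mem_image hinj.injOn]
  refine finprod_mem_congr rfl fun x _ => ?_
  have hconj : τ * ((halfTransferFactor hH (hw.comp_mul he hinj heτ).smul_base σ x : H) : G) * τ⁻¹ =
      (halfTransferFactor hH hw.smul_base σ (e x) : G) := by
    rw [coe_halfTransferFactor_comp_mul hH hw he hinj heτ σ x]; group
  have hmem : τ * ((halfTransferFactor hH (hw.comp_mul he hinj heτ).smul_base σ x : H) : G) * τ⁻¹ ∈ H := by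
    rw [hconj]; exact (halfTransferFactor hH hw.smul_base σ (e x)).2
  rw [← hϕ' _ hmem]
  congr 1
  exact Subtype.ext hconj.symm

/-- **`F_{e(Φ)}^{ϕ}(σ) = F_Φ^{ϕ′}(σ)` (section-free)** for a CM type `Φ`, `ι² = 1`, `X` finite and `G`-transitive, an
equivariant injection `e` with `e(τ • x₀) = x₀`, and `ϕ′(h) = ϕ(τhτ⁻¹)` — PROP. 4.8 (b) at the level of `F`:
`F_{Φτ⁻¹}(σ) = τ F_Φ(σ) τ⁻¹`. [cite: Milne2007FundamentalCM, §4.2 Prop. 4.8 (b), Lemma 4.4] -/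
theorem halfTransfer_image_eq [Finite X] [MulAction.IsPretransitive G X] {Φ : Set X} (hΦ : IsCMTypeWith ι Φ)
    (hι : ι * ι = 1) {e : X → X} {τ : G} (he : ∀ (g : G) (x : X), e (g • x) = g • e x)
    (hinj : Function.Injective e) (heτ : e (τ • x₀) = x₀) (ϕ' : H →* A)
    (hϕ' : ∀ (h : H) (hmem : τ * (h : G) * τ⁻¹ ∈ H), ϕ ⟨τ * h * τ⁻¹, hmem⟩ = ϕ' h) (σ : G) :
    halfTransfer ϕ x₀ hH ι (e '' Φ) σ = halfTransfer ϕ' x₀ hH ι Φ σ := by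
  obtain ⟨w, hw⟩ := exists_isSymmSection hι x₀ hΦ
  rw [halfTransfer_eq_halfTransferWith ϕ hH
      (hΦ.image_of_equivariant he ⟨hinj, Finite.surjective_of_injective hinj⟩) hw,
    halfTransfer_eq_halfTransferWith ϕ' hH hΦ (hw.comp_mul he hinj heτ),
    halfTransferWith_image_eq ϕ hH hw he hinj heτ Φ ϕ' hϕ' σ]

end GroupTheory

/-! #### `X = G ⧸ H`: the right translate `Φτ⁻¹` by an element of the normaliser -/

section Quotient

variable {G : Type*} [Group G] {H : Subgroup G} {A : Type*} [CommGroup A]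

namespace HalfTransfer

/-- **`Φτ⁻¹ = {gτ⁻¹H : gH ∈ Φ} ⊆ G ⧸ H`** — Milne's `Φ ↦ Φ(τ⁻¹|E)` on `Hom(E, ℚ̄) = Γ_ℚ ⧸ Γ_E` (`(gτ⁻¹)|E = g|E ∘ (τ⁻¹|E)`).
Defined for every `τ`; it is the action of `op τ⁻¹ ∈ N_G(H)ᵒᵖ` (Mathlib `MulAction.right_quotientAction`) when `τ`
normalises `H` (`translateType_eq_image_smul`) — the case «`τE = E`».
[cite: Milne2007FundamentalCM, §4.2 Prop. 4.8 (b)] -/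
def translateType (τ : G) (Φ : Set (G ⧸ H)) : Set (G ⧸ H) :=
  (fun g : G => ((g * τ⁻¹ : G) : G ⧸ H)) '' ((QuotientGroup.mk : G → G ⧸ H) ⁻¹' Φ)

/-- Membership: `q ∈ Φτ⁻¹ ↔ q = gτ⁻¹H` for some `gH ∈ Φ`. [cite: Milne2007FundamentalCM, §4.2 Prop. 4.8 (b)] -/
theorem mem_translateType {τ : G} {Φ : Set (G ⧸ H)} {q : G ⧸ H} :
    q ∈ translateType τ Φ ↔ ∃ g : G, (g : G ⧸ H) ∈ Φ ∧ ((g * τ⁻¹ : G) : G ⧸ H) = q := by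
  simp only [translateType, Set.mem_image, Set.mem_preimage]

/-- `gτ⁻¹H ∈ Φτ⁻¹` for `gH ∈ Φ`. [cite: Milne2007FundamentalCM, §4.2 Prop. 4.8 (b)] -/
theorem coe_mul_inv_mem_translateType {τ : G} {Φ : Set (G ⧸ H)} {g : G} (hg : (g : G ⧸ H) ∈ Φ) :
    ((g * τ⁻¹ : G) : G ⧸ H) ∈ translateType τ Φ :=
  mem_translateType.2 ⟨g, hg, rfl⟩

/-- `Φ·1⁻¹ = Φ`. [cite: Milne2007FundamentalCM, §4.2 Prop. 4.8] -/
theorem translateType_one (Φ : Set (G ⧸ H)) : translateType (1 : G) Φ = Φ := by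
  ext q
  rw [mem_translateType]
  constructor
  · rintro ⟨g, hg, rfl⟩; rwa [inv_one, mul_one]
  · intro hq
    obtain ⟨g, rfl⟩ := QuotientGroup.mk_surjective q
    exact ⟨g, hq, by rw [inv_one, mul_one]⟩

/-- **`Φτ⁻¹ = Φ` for `τ ∈ H`** (`gτ⁻¹H = gH`): elements of `res(Γ_E)` do not move CM types.
[cite: Milne2007FundamentalCM, §4.2 Prop. 4.8 (b)] -/
theorem translateType_eq_self_of_mem {τ : G} (hτ : τ ∈ H) (Φ : Set (G ⧸ H)) : translateType τ Φ = Φ := by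
  have key : ∀ g : G, ((g * τ⁻¹ : G) : G ⧸ H) = (g : G ⧸ H) := fun g =>
    QuotientGroup.eq.2 (by rw [mul_inv_rev, inv_inv, inv_mul_cancel_right]; exact hτ)
  ext q
  rw [mem_translateType]
  constructor
  · rintro ⟨g, hg, rfl⟩; rwa [key]
  · intro hq
    obtain ⟨g, rfl⟩ := QuotientGroup.mk_surjective q
    exact ⟨g, hq, key g⟩

variable {τ : G} (hτ : τ ∈ Subgroup.normalizer (H : Set G))
include hτ

/-- `τhτ⁻¹ ∈ H` for `h ∈ H` and `τ ∈ N_G(H)`. [cite: Milne2007FundamentalCM, §4.2 Prop. 4.8 (b) («if τE = E»)] -/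
theorem conj_mem_of_mem_normalizer {h : G} (hh : h ∈ H) : τ * h * τ⁻¹ ∈ H :=
  (Subgroup.mem_normalizer_iff.1 hτ h).1 hh

/-- `op τ⁻¹ ∈ N_G(H)ᵒᵖ`. [cite: Milne2007FundamentalCM, §4.2 Prop. 4.8 (b)] -/
theorem op_inv_mem_normalizer_op : MulOpposite.op τ⁻¹ ∈ (Subgroup.normalizer (H : Set G)).op :=
  Subgroup.mem_op.2 (by rw [MulOpposite.unop_op]; exact inv_mem hτ)

/-- The action of `op τ⁻¹ ∈ N_G(H)ᵒᵖ` on `G ⧸ H` is `gH ↦ gτ⁻¹H`. [cite: Milne2007FundamentalCM, §4.2 Prop. 4.8 (b)] -/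
theorem normalizerOp_smul_coe (g : G) :
    (⟨MulOpposite.op τ⁻¹, op_inv_mem_normalizer_op hτ⟩ : (Subgroup.normalizer (H : Set G)).op) • (g : G ⧸ H) =
      ((g * τ⁻¹ : G) : G ⧸ H) := rfl

/-- **For `τ ∈ N_G(H)`, `Φτ⁻¹` is the image of `Φ` under the right translation `gH ↦ gτ⁻¹H`** (a well-defined
permutation of `G ⧸ H`). [cite: Milne2007FundamentalCM, §4.2 Prop. 4.8 (b)] -/
theorem translateType_eq_image_smul (Φ : Set (G ⧸ H)) :
    translateType τ Φ =
      (fun q : G ⧸ H => (⟨MulOpposite.op τ⁻¹, op_inv_mem_normalizer_op hτ⟩ : (Subgroup.normalizer (H : Set G)).op) • q) '' Φ := by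
  ext q
  rw [mem_translateType, Set.mem_image]
  constructor
  · rintro ⟨g, hg, rfl⟩
    exact ⟨(g : G ⧸ H), hg, normalizerOp_smul_coe hτ g⟩
  · rintro ⟨q₀, hq₀, rfl⟩
    obtain ⟨g, rfl⟩ := QuotientGroup.mk_surjective q₀
    exact ⟨g, hq₀, (normalizerOp_smul_coe hτ g).symm⟩

/-- `gτ⁻¹H ∈ Φτ⁻¹ ↔ gH ∈ Φ` for `τ ∈ N_G(H)`. [cite: Milne2007FundamentalCM, §4.2 Prop. 4.8 (b)] -/
theorem coe_mul_inv_mem_translateType_iff (Φ : Set (G ⧸ H)) (g : G) :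
    ((g * τ⁻¹ : G) : G ⧸ H) ∈ translateType τ Φ ↔ (g : G ⧸ H) ∈ Φ := by
  rw [translateType_eq_image_smul hτ, ← normalizerOp_smul_coe hτ g,
    (MulAction.injective _).mem_set_image]

/-- The right translation is `G`-equivariant: `(σ·q)τ⁻¹ = σ·(qτ⁻¹)`. [cite: Milne2007FundamentalCM, §4.2 Prop. 4.8 (b)] -/
theorem normalizerOp_smul_smul (σ : G) (q : G ⧸ H) :
    (⟨MulOpposite.op τ⁻¹, op_inv_mem_normalizer_op hτ⟩ : (Subgroup.normalizer (H : Set G)).op) • (σ • q) =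
      σ • ((⟨MulOpposite.op τ⁻¹, op_inv_mem_normalizer_op hτ⟩ : (Subgroup.normalizer (H : Set G)).op) • q) := by
  induction q using QuotientGroup.induction_on with
  | H g =>
    rw [MulAction.Quotient.smul_coe H σ g, smul_eq_mul, normalizerOp_smul_coe hτ, normalizerOp_smul_coe hτ,
      MulAction.Quotient.smul_coe H σ, smul_eq_mul, mul_assoc]

/-- The right translation by `τ⁻¹` sends `τ·(1H)` to the base point `1H`. [cite: Milne2007FundamentalCM, §4.2 Prop. 4.8 (b)] -/
theorem normalizerOp_smul_smul_one :
    (⟨MulOpposite.op τ⁻¹, op_inv_mem_normalizer_op hτ⟩ : (Subgroup.normalizer (H : Set G)).op) • (τ • ((1 : G) : G ⧸ H)) =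
      ((1 : G) : G ⧸ H) := by
  rw [MulAction.Quotient.smul_coe H τ, smul_eq_mul, normalizerOp_smul_coe hτ, mul_one, mul_inv_cancel]

end HalfTransfer

/-- **PROP. 4.8 (b) AT THE LEVEL OF `F` ON `G ⧸ H`: `F_{Φτ⁻¹}^{ϕ}(σ) = F_Φ^{ϕ ∘ Inn(τ)}(σ)`** for `τ ∈ N_G(H)`, a CM type
`Φ ⊆ G ⧸ H` (w.r.t. `ι`, `ι² = 1`, `H` of finite index) and `ϕ′(h) = ϕ(τhτ⁻¹)`.
[cite: Milne2007FundamentalCM, §4.2 Prop. 4.8 (b)] -/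
theorem halfTransfer_translateType [H.FiniteIndex] (ϕ : H →* A) {ι τ : G} {Φ : Set (G ⧸ H)}
    (hΦ : IsCMTypeWith ι Φ) (hι : ι * ι = 1) (hτ : τ ∈ Subgroup.normalizer (H : Set G)) (ϕ' : H →* A)
    (hϕ' : ∀ (h : H) (hmem : τ * (h : G) * τ⁻¹ ∈ H), ϕ ⟨τ * h * τ⁻¹, hmem⟩ = ϕ' h) (σ : G) :
    halfTransfer ϕ ((1 : G) : G ⧸ H) (mem_iff_smul_quotient_one_eq (H := H)) ι (translateType τ Φ) σ =
      halfTransfer ϕ' ((1 : G) : G ⧸ H) (mem_iff_smul_quotient_one_eq (H := H)) ι Φ σ := by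
  haveI : Finite (G ⧸ H) := Subgroup.finite_quotient_of_finiteIndex
  rw [translateType_eq_image_smul hτ]
  exact halfTransfer_image_eq ϕ _ hΦ hι (fun σ' q => normalizerOp_smul_smul hτ σ' q) (MulAction.injective _)
    (normalizerOp_smul_smul_one hτ) ϕ' hϕ' σ

end Quotient

/-! ### §2. `τE = E`: elements of `Γ_ℚ` inducing an automorphism of `K`; the dictionary with complex CM types -/

section Normaliser

variable (K : Type) [Field K] [NumberField K] {τ : absoluteGaloisGroup ℚ} {α : K ≃ₐ[ℚ] K}
  (hτ : ∀ x : K, τ • (absEmbedding ℚ K x : AlgebraicClosure ℚ) = absEmbedding ℚ K (α x))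
include hτ

/-- `τ⁻¹ • e x = e (α⁻¹ x)`. [cite: Milne2007FundamentalCM, §4.2 Prop. 4.8 (b) («Φ(τ⁻¹|E)»)] -/
theorem inv_smul_absEmbedding (x : K) :
    τ⁻¹ • (absEmbedding ℚ K x : AlgebraicClosure ℚ) = absEmbedding ℚ K (α.symm x) := by
  rw [inv_smul_eq_iff, hτ, AlgEquiv.apply_symm_apply]

/-- **«`τE = E`» ⟹ `τ` normalises `H = res(Γ_K)`** (`H` = the pointwise stabiliser of `e(K)`): for `h ∈ Γ_ℚ`,
`h` fixes `e(K)` iff `τhτ⁻¹` does. [cite: Milne2007FundamentalCM, §4.2 Prop. 4.8 (b)] -/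
theorem mem_normalizer_of_smul_absEmbedding : τ ∈ Subgroup.normalizer ((absGaloisRestrict ℚ K).range : Set (absoluteGaloisGroup ℚ)) := by
  refine Subgroup.mem_normalizer_iff.2 fun h => ?_
  rw [mem_range_absGaloisRestrict_iff_smul_absEmbedding, mem_range_absGaloisRestrict_iff_smul_absEmbedding]
  constructor
  · intro hh x
    rw [mul_smul, mul_smul, inv_smul_absEmbedding K hτ, hh, hτ, AlgEquiv.apply_symm_apply]
  · intro hh x
    have h1 := hh (α x)
    rw [mul_smul, mul_smul, inv_smul_absEmbedding K hτ, AlgEquiv.symm_apply_apply, ← hτ] at h1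
    exact MulAction.injective τ h1

/-- **`ϕ(τhτ⁻¹) = θ_τ^ab(ϕ h)` on `H = res(Γ_K)`**, `ϕ = absGaloisRangeAbProj ℚ K : res σ ↦ [σ]`, `θ_τ = absGaloisConj hτ`
(`res(θ_τ σ) = τ res(σ) τ⁻¹`): the hypothesis `hϕ'` of §1 for `ϕ′ = θ_τ^ab ∘ ϕ`.
[cite: Milne2007FundamentalCM, §4.2 Prop. 4.8 (b)] [cite: NeukirchANT1999, Ch. IV §5 Prop. (5.8)] -/
theorem absGaloisRangeAbProj_conj_of_smul_absEmbedding (h : (absGaloisRestrict ℚ K).range)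
    (hmem : τ * (h : absoluteGaloisGroup ℚ) * τ⁻¹ ∈ (absGaloisRestrict ℚ K).range) :
    absGaloisRangeAbProj ℚ K ⟨τ * h * τ⁻¹, hmem⟩ =
      ((absGaloisConjAb hτ).toMonoidHom.comp (absGaloisRangeAbProj ℚ K)) h := by
  obtain ⟨σ, hσ⟩ := h.2
  have hσ' : absGaloisRestrict ℚ K σ = (h : absoluteGaloisGroup ℚ) := hσ
  change absGaloisRangeAbProj ℚ K ⟨τ * h * τ⁻¹, hmem⟩ = absGaloisConjAb hτ (absGaloisRangeAbProj ℚ K h)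
  rw [absGaloisRangeAbProj_eq_of_eq hσ', absGaloisConjAb_absGaloisAbProj]
  refine absGaloisRangeAbProj_eq_of_eq ?_
  change absGaloisRestrict ℚ K _ = τ * (h : absoluteGaloisGroup ℚ) * τ⁻¹
  rw [absGaloisRestrict_absGaloisConj, hσ']

/-- **`(gτ⁻¹) ∘ e = (g ∘ e) ∘ α⁻¹` read in `ℂ`**: `embOfCoset K j (gτ⁻¹H) = embOfCoset K j (gH) ∘ α⁻¹` — the right
translate by `τ⁻¹` IS Milne's `φ ↦ φ ∘ (τ⁻¹|E)`. [cite: Milne2007FundamentalCM, §4.2 Prop. 4.8 (b) («Φ(τ⁻¹|E)»)] -/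
theorem embOfCoset_coe_mul_inv (j : AlgebraicClosure ℚ →+* ℂ) (g : absoluteGaloisGroup ℚ) :
    embOfCoset K j ((g * τ⁻¹ : absoluteGaloisGroup ℚ) : absoluteGaloisGroup ℚ ⧸ (absGaloisRestrict ℚ K).range) =
      (embOfCoset K j (g : absoluteGaloisGroup ℚ ⧸ (absGaloisRestrict ℚ K).range)).comp (α.symm : K →+* K) := by
  rw [embOfCoset_mk, embOfCoset_mk]
  exact RingHom.ext fun x => by
    rw [embOfElement_apply, RingHom.comp_apply, embOfElement_apply, mul_smul, inv_smul_absEmbedding K hτ]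
    rfl

/-- **THE DICTIONARY WITH COMPLEX CM TYPES.**  For `Φ, Φ′ : CMType K` with `s ∈ Φ′ ↔ s ∘ α ∈ Φ` (the tree's
`Φ′ = cmTypeMap α Φ`, «`σΦ = {s | s ∘ σ ∈ Φ}`»; Milne's `Φ′ = Φ(τ⁻¹|E) = {φ ∘ α⁻¹}`; Deligne's `τΦ`) and any
`j : ℚ̄ → ℂ`: **`(embOfCoset K j ⁻¹ Φ)·τ⁻¹ = embOfCoset K j ⁻¹ Φ′`** on `Γ_ℚ ⧸ res(Γ_K)`.
[cite: Milne2007FundamentalCM, §4.2 Prop. 4.8 (b)] [cite: Deligne1982HodgeCycles, §5 («A_{σΦ}», TeXed re-edition p. 38)] -/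
theorem translateType_preimage_cmType (j : AlgebraicClosure ℚ →+* ℂ) (Φ Φ' : CMType K)
    (hΦ' : ∀ s : K →+* ℂ, s ∈ Φ'.1 ↔ s.comp (α : K →+* K) ∈ Φ.1) :
    translateType τ (embOfCoset K j ⁻¹' Φ.1) = embOfCoset K j ⁻¹' Φ'.1 := by
  have hcomp : ∀ s : K →+* ℂ, (s.comp (α.symm : K →+* K)).comp (α : K →+* K) = s := fun s =>
    RingHom.ext fun x => by
      change s (α.symm (α x)) = s x
      rw [AlgEquiv.symm_apply_apply]
  ext q
  obtain ⟨g, rfl⟩ := QuotientGroup.mk_surjective q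
  have hg : (g : absoluteGaloisGroup ℚ ⧸ (absGaloisRestrict ℚ K).range) =
      ((g * τ * τ⁻¹ : absoluteGaloisGroup ℚ) : absoluteGaloisGroup ℚ ⧸ (absGaloisRestrict ℚ K).range) := by
    rw [mul_inv_cancel_right]
  rw [hg, coe_mul_inv_mem_translateType_iff (mem_normalizer_of_smul_absEmbedding K hτ), Set.mem_preimage,
    Set.mem_preimage, embOfCoset_coe_mul_inv K hτ j, hΦ', hcomp]

variable {K} {φ : ℚ →+* ℝ} {c : absoluteGaloisGroup ℚ} (hc : IsComplexConjugation φ c)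
  {Ψ : Set (absoluteGaloisGroup ℚ ⧸ (absGaloisRestrict ℚ K).range)} (hΨ : IsCMTypeWith c Ψ)
include hc hΨ

omit hτ hΨ in
/-- `c·c = 1` for a complex conjugation. [cite: Milne2007FundamentalCM, §4.2] -/
private theorem cc_eq_one : c * c = 1 := by rw [← pow_two, hc.sq_eq_one]

omit hτ hc in
/-- **`Ψτ⁻¹` is a CM type** (for `c`) whenever `Ψ` is and `τ` normalises `res(Γ_K)` (the right translation is an
equivariant permutation of `Γ_ℚ ⧸ res(Γ_K)`). [cite: Milne2007FundamentalCM, §4.2 Prop. 4.8 (b)] -/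
theorem isCMTypeWith_translateType (hτn : τ ∈ Subgroup.normalizer ((absGaloisRestrict ℚ K).range : Set (absoluteGaloisGroup ℚ))) :
    IsCMTypeWith c (translateType τ Ψ) := by
  rw [translateType_eq_image_smul hτn]
  exact hΨ.image_of_equivariant (fun σ q => normalizerOp_smul_smul hτn σ q) (MulAction.bijective _)

/-! ### §3. `F_{Ψτ⁻¹}(σ) = θ_τ^ab (F_Ψ(σ))` -/

/-- **PROP. 4.8 (b) AT THE LEVEL OF `F`: `F_{Ψτ⁻¹}(σ) = θ_τ^ab(F_Ψ(σ))`** («`F_{Φ(τ⁻¹|E)}(σ) = τ F_Φ(σ) τ⁻¹`») for a CM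
type `Ψ ⊆ Γ_ℚ ⧸ res(Γ_K)` and `τ ∈ Γ_ℚ` inducing `α ∈ Aut(K)` on `e(K)`; `θ_τ^ab = absGaloisConjAb hτ` is conjugation by
(the lift of) `τ` on `Γ_K^ab = Gal(K^ab/K)`.  PROOF: §1 with `ϕ′ = θ_τ^ab ∘ ϕ` and transport along `θ_τ^ab`
(`map_halfTransfer`). [cite: Milne2007FundamentalCM, §4.2 Prop. 4.8 (b), Lemma 4.4] -/
theorem tateHalfTransfer_translateType (σ : absoluteGaloisGroup ℚ) :
    tateHalfTransfer K c (translateType τ Ψ) σ = absGaloisConjAb hτ (tateHalfTransfer K c Ψ σ) := by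
  haveI : (absGaloisRestrict ℚ K).range.FiniteIndex := Subgroup.finiteIndex_of_finite_quotient
  rw [tateHalfTransfer, tateHalfTransfer,
    halfTransfer_translateType _ hΨ (cc_eq_one hc) (mem_normalizer_of_smul_absEmbedding K hτ) _
      (absGaloisRangeAbProj_conj_of_smul_absEmbedding K hτ) σ]
  exact (map_halfTransfer _ _ hΨ (cc_eq_one hc) (absGaloisConjAb hτ).toMonoidHom σ).symm

omit hτ hc hΨ in
/-- `F_{Ψτ⁻¹} = F_Ψ` for `τ ∈ res(Γ_K)` (then `Ψτ⁻¹ = Ψ`). [cite: Milne2007FundamentalCM, §4.2 Prop. 4.8 (b)] -/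
theorem tateHalfTransfer_translateType_of_mem_range {τ : absoluteGaloisGroup ℚ}
    (hτH : τ ∈ (absGaloisRestrict ℚ K).range) (σ : absoluteGaloisGroup ℚ) :
    tateHalfTransfer K c (translateType τ Ψ) σ = tateHalfTransfer K c Ψ σ := by
  rw [translateType_eq_self_of_mem hτH]

end Normaliser

/-! ### §4. `Aut(K)` on finite idèles and on `𝔸^×_{K,f}/K^×`; compatibilities with `ι_K`, `χ(σ)` and `[·, K]` -/

section FiniteIdeleGal

variable (K : Type) [Field K] [NumberField K]

/-- **`α ∈ Aut(K) = (K ≃ₐ[ℚ] K)` on the finite idèles `(𝔸_{K,f})ˣ`**: the componentwise Galois action of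
`…Automorphic/GaloisActionAdeleRing` (`(α y)_{αw} = α_w(y_w)`) on units — Milne's «`τ f_Φ(σ)`» for `τ|E = α`.
[cite: Milne2007FundamentalCM, §4.2 Prop. 4.8 (b)] -/
def finiteIdeleGal (α : K ≃ₐ[ℚ] K) : (FiniteAdeleRing (𝓞 K) K)ˣ →* (FiniteAdeleRing (𝓞 K) K)ˣ :=
  Units.map (MulSemiringAction.toRingHom (K ≃ₐ[ℚ] K) (FiniteAdeleRing (𝓞 K) K) α :
    FiniteAdeleRing (𝓞 K) K →* FiniteAdeleRing (𝓞 K) K)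

/-- Unfolding: `(α y : 𝔸_{K,f}) = α • (y : 𝔸_{K,f})`. [cite: Milne2007FundamentalCM, §4.2 Prop. 4.8 (b)] -/
@[simp] theorem coe_finiteIdeleGal (α : K ≃ₐ[ℚ] K) (y : (FiniteAdeleRing (𝓞 K) K)ˣ) :
    ((finiteIdeleGal K α y : (FiniteAdeleRing (𝓞 K) K)ˣ) : FiniteAdeleRing (𝓞 K) K) =
      α • (y : FiniteAdeleRing (𝓞 K) K) := rfl

/-- `finiteIdeleGal K 1 = id`. [cite: Milne2007FundamentalCM, §4.2 Prop. 4.8] -/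
theorem finiteIdeleGal_one (y : (FiniteAdeleRing (𝓞 K) K)ˣ) : finiteIdeleGal K 1 y = y :=
  Units.ext (by rw [coe_finiteIdeleGal, one_smul])

/-- `finiteIdeleGal K (α β) = finiteIdeleGal K α ∘ finiteIdeleGal K β`. [cite: Milne2007FundamentalCM, §4.2 Prop. 4.8] -/
theorem finiteIdeleGal_mul (α β : K ≃ₐ[ℚ] K) (y : (FiniteAdeleRing (𝓞 K) K)ˣ) :
    finiteIdeleGal K (α * β) y = finiteIdeleGal K α (finiteIdeleGal K β y) :=
  Units.ext (by rw [coe_finiteIdeleGal, coe_finiteIdeleGal, coe_finiteIdeleGal, mul_smul])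

/-- **`α (a) = (α a)` on principal finite idèles.** [cite: Milne2007FundamentalCM, §4.2 Prop. 4.8 (b) («E^×»)] -/
theorem finiteIdeleGal_unitEmbedding (α : K ≃ₐ[ℚ] K) (a : Kˣ) :
    finiteIdeleGal K α (FiniteAdeleRing.unitEmbedding (𝓞 K) K a) =
      FiniteAdeleRing.unitEmbedding (𝓞 K) K (Units.map (α : K →* K) a) :=
  Units.ext (by
    rw [coe_finiteIdeleGal, FiniteAdeleRing.unitEmbedding_apply, FiniteAdeleRing.unitEmbedding_apply,
      Literature.NumberTheory.Automorphic.FiniteAdeleRing.smul_algebraMap]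
    rfl)

/-- `α` maps `K^×` onto itself. [cite: Milne2007FundamentalCM, §4.2 Prop. 4.8 (b)] -/
theorem range_unitEmbedding_le_comap_finiteIdeleGal (α : K ≃ₐ[ℚ] K) :
    (FiniteAdeleRing.unitEmbedding (𝓞 K) K).range ≤
      ((FiniteAdeleRing.unitEmbedding (𝓞 K) K).range).comap (finiteIdeleGal K α) := by
  rintro _ ⟨a, rfl⟩
  rw [Subgroup.mem_comap, finiteIdeleGal_unitEmbedding]
  exact ⟨_, rfl⟩

/-- **`α ∈ Aut(K)` on `𝔸^×_{K,f}/K^×`** — Milne's «`τ f_Φ(σ)`». [cite: Milne2007FundamentalCM, §4.2 Prop. 4.8 (b)] -/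
def finiteClassGal (α : K ≃ₐ[ℚ] K) : (FiniteAdeleRing (𝓞 K) K)ˣ ⧸ (FiniteAdeleRing.unitEmbedding (𝓞 K) K).range →*
    (FiniteAdeleRing (𝓞 K) K)ˣ ⧸ (FiniteAdeleRing.unitEmbedding (𝓞 K) K).range :=
  QuotientGroup.map _ _ (finiteIdeleGal K α) (range_unitEmbedding_le_comap_finiteIdeleGal K α)

/-- Unfolding: `α (y·K^×) = (α y)·K^×`. [cite: Milne2007FundamentalCM, §4.2 Prop. 4.8 (b)] -/
@[simp] theorem finiteClassGal_mk (α : K ≃ₐ[ℚ] K) (y : (FiniteAdeleRing (𝓞 K) K)ˣ) :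
    finiteClassGal K α (QuotientGroup.mk y) = QuotientGroup.mk (finiteIdeleGal K α y) := rfl

/-- `finiteClassGal K 1 = id`. [cite: Milne2007FundamentalCM, §4.2 Prop. 4.8] -/
theorem finiteClassGal_one (f : (FiniteAdeleRing (𝓞 K) K)ˣ ⧸ (FiniteAdeleRing.unitEmbedding (𝓞 K) K).range) :
    finiteClassGal K 1 f = f := by
  induction f using QuotientGroup.induction_on with
  | H y => rw [finiteClassGal_mk, finiteIdeleGal_one]

/-- `finiteClassGal K (αβ) = finiteClassGal K α ∘ finiteClassGal K β`. [cite: Milne2007FundamentalCM, §4.2 Prop. 4.8] -/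
theorem finiteClassGal_mul (α β : K ≃ₐ[ℚ] K)
    (f : (FiniteAdeleRing (𝓞 K) K)ˣ ⧸ (FiniteAdeleRing.unitEmbedding (𝓞 K) K).range) :
    finiteClassGal K (α * β) f = finiteClassGal K α (finiteClassGal K β f) := by
  induction f using QuotientGroup.induction_on with
  | H y => rw [finiteClassGal_mk, finiteClassGal_mk, finiteClassGal_mk, finiteIdeleGal_mul]

/-- `α (x_𝐡) = (α • x)_𝐡`: the action on `𝕀_K = K_∞^× × (𝔸_{K,f})ˣ` is componentwise.
[cite: CasselsFrohlichANT1967, Ch. VII §1.1] -/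
theorem finiteIdeleGal_finitePart (α : K ≃ₐ[ℚ] K) (x : ideleGroup K) :
    finiteIdeleGal K α (IdeleAction.finitePart K x) = IdeleAction.finitePart K (α • x) :=
  Units.ext rfl

/-- **`α • χ(σ) = χ(σ)`**: `χ(σ) = (con_{K/ℚ}(1, χ_cyc σ))_𝐡` comes from `𝕀_ℚ`, fixed by `Aut(K)`
(`smul_units_map_baseChange_rat`). [cite: Milne2007FundamentalCM, §4.2 Prop. 4.8 (proof: «f·ιf = χ(σ)χ(τ)E^×»)] -/
theorem finiteIdeleGal_cyclotomicFiniteIdeleIn (α : K ≃ₐ[ℚ] K) (σ : absoluteGaloisGroup ℚ) :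
    finiteIdeleGal K α (cyclotomicFiniteIdeleIn K σ) = cyclotomicFiniteIdeleIn K σ := by
  rw [cyclotomicFiniteIdeleIn_apply, finiteIdeleGal_finitePart, smul_units_map_baseChange_rat K α]

/-- **`α • (1, y) = (1, α y)` in `𝕀_K`.** [cite: Milne2007FundamentalCM, §4.2 Prop. 4.8 (b)] -/
theorem smul_units_map_inr (α : K ≃ₐ[ℚ] K) (y : (FiniteAdeleRing (𝓞 K) K)ˣ) :
    α • ((Units.map (N := AdeleRing (𝓞 K) K)
          (MonoidHom.inr (InfiniteAdeleRing K) (FiniteAdeleRing (𝓞 K) K))) y) = (Units.map (N := AdeleRing (𝓞 K) K)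
          (MonoidHom.inr (InfiniteAdeleRing K) (FiniteAdeleRing (𝓞 K) K))) (finiteIdeleGal K α y) := by
  apply Units.ext
  rw [Literature.NumberTheory.Automorphic.AdeleRing.coe_smul_units]
  change α • ((1, (y : FiniteAdeleRing (𝓞 K) K)) : AdeleRing (𝓞 K) K) =
    ((1, ((finiteIdeleGal K α y : (FiniteAdeleRing (𝓞 K) K)ˣ) : FiniteAdeleRing (𝓞 K) K)) : AdeleRing (𝓞 K) K)
  rw [Literature.NumberTheory.Automorphic.AdeleRing.smul_mk, smul_one, coe_finiteIdeleGal]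

variable {K} {τ : absoluteGaloisGroup ℚ} {α : K ≃ₐ[ℚ] K}
  (hτ : ∀ x : K, τ • (absEmbedding ℚ K x : AlgebraicClosure ℚ) = absEmbedding ℚ K (α x))
include hτ

/-- **«`art_E(τf) = τ art_E(f) τ⁻¹`»: `θ_τ^ab [(1, y), K] = [(1, α y), K]`** for every finite idèle `y` (FILE 1
`absGaloisConjAb_ideleArtinMap_rat` — Neukirch IV (5.8) in the limit, no Galois hypothesis — at `x = (1, y)`).
[cite: Milne2007FundamentalCM, §4.2 Prop. 4.8 (b)] [cite: NeukirchANT1999, Ch. IV §5 Prop. (5.8)] -/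
theorem absGaloisConjAb_ideleArtinMap_inr_of_smul_absEmbedding (y : (FiniteAdeleRing (𝓞 K) K)ˣ) :
    absGaloisConjAb hτ (ideleArtinMap K ((Units.map (N := AdeleRing (𝓞 K) K)
          (MonoidHom.inr (InfiniteAdeleRing K) (FiniteAdeleRing (𝓞 K) K))) y)) =
      ideleArtinMap K ((Units.map (N := AdeleRing (𝓞 K) K)
            (MonoidHom.inr (InfiniteAdeleRing K) (FiniteAdeleRing (𝓞 K) K))) (finiteIdeleGal K α y)) := by
  rw [absGaloisConjAb_ideleArtinMap_rat hτ, smul_units_map_inr]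

/-- The same on classes (`K` totally complex): `θ_τ^ab (finiteClassArtinMap K f) = finiteClassArtinMap K (α f)`.
[cite: Milne2007FundamentalCM, §4.2 Prop. 4.8 (b)] -/
theorem absGaloisConjAb_finiteClassArtinMap_of_smul_absEmbedding [IsTotallyComplex K]
    (f : (FiniteAdeleRing (𝓞 K) K)ˣ ⧸ (FiniteAdeleRing.unitEmbedding (𝓞 K) K).range) :
    absGaloisConjAb hτ (finiteClassArtinMap K f) = finiteClassArtinMap K (finiteClassGal K α f) := by
  induction f using QuotientGroup.induction_on with
  | H y => rw [finiteClassArtinMap_mk, finiteClassGal_mk, finiteClassArtinMap_mk,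
      absGaloisConjAb_ideleArtinMap_inr_of_smul_absEmbedding hτ]

end FiniteIdeleGal

section CM

variable (K : Type) [Field K] [NumberField K] [IsCMField K]

/-- **`ι_K` on `(𝔸_{K,f})ˣ` IS `finiteIdeleGal K (complexConjRat K)`** (row A3-G45's `finiteIdeleConjGal`, defined through
`Gal(K/K⁺)`, and the `Aut(K)`-action agree: the action depends only on the underlying automorphism, FILE 1 §1).
[cite: Milne2007FundamentalCM, §4.2 Prop. 4.6 (b), Prop. 4.8 (b)] -/
theorem finiteIdeleConjGal_eq_finiteIdeleGal : finiteIdeleConjGal K = finiteIdeleGal K (complexConjRat K) :=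
  units_map_toRingHom_finiteAdeleRing_eq_of_forall_apply_eq (σ := IsCMField.complexConj K)
    (σ' := complexConjRat K) fun _ => rfl

/-- **Every automorphism of a CM field commutes with complex conjugation**: `α (ι_K x) = ι_K (α x)` (read through an
embedding `φ : K → ℂ`: `φ ∘ α` is another embedding and `ψ ∘ ι_K = conj ∘ ψ` for all `ψ`).
[cite: Milne2007FundamentalCM, §1 («the involution ι_E … φ ∘ ι_E = ι ∘ φ for every φ : E → ℂ»), §4.2 Prop. 4.8 (b)] -/
theorem algEquiv_complexConj_comm (α : K ≃ₐ[ℚ] K) (x : K) :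
    α (IsCMField.complexConj K x) = IsCMField.complexConj K (α x) := by
  let ψ : K →+* ℂ := Classical.choice inferInstance
  apply ψ.injective
  have h1 := IsCMField.complexEmbedding_complexConj (K := K) (ψ.comp (α : K →+* K)) x
  have h2 := IsCMField.complexEmbedding_complexConj (K := K) ψ (α x)
  rw [RingHom.comp_apply, RingHom.comp_apply] at h1
  change ψ (α (IsCMField.complexConj K x)) = starRingEnd ℂ (ψ (α x)) at h1
  rw [h1, h2]

/-- `α ∘ ι_K = ι_K ∘ α` in `Aut(K)`. [cite: Milne2007FundamentalCM, §4.2 Prop. 4.8 (b)] -/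
theorem mul_complexConjRat_comm (α : K ≃ₐ[ℚ] K) : α * complexConjRat K = complexConjRat K * α :=
  AlgEquiv.ext fun x => by
    rw [AlgEquiv.mul_apply, AlgEquiv.mul_apply, complexConjRat_apply, complexConjRat_apply,
      algEquiv_complexConj_comm]

/-- **`α (ι_K y) = ι_K (α y)` on finite idèles.** [cite: Milne2007FundamentalCM, §4.2 Prop. 4.8 (b)] -/
theorem finiteIdeleGal_finiteIdeleConjGal (α : K ≃ₐ[ℚ] K) (y : (FiniteAdeleRing (𝓞 K) K)ˣ) :
    finiteIdeleGal K α (finiteIdeleConjGal K y) = finiteIdeleConjGal K (finiteIdeleGal K α y) := by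
  rw [finiteIdeleConjGal_eq_finiteIdeleGal, ← finiteIdeleGal_mul, mul_complexConjRat_comm, finiteIdeleGal_mul]

/-- `α (ι_K f) = ι_K (α f)` on `𝔸^×_{K,f}/K^×`. [cite: Milne2007FundamentalCM, §4.2 Prop. 4.8 (b)] -/
theorem finiteClassGal_finiteClassConjGal (α : K ≃ₐ[ℚ] K)
    (f : (FiniteAdeleRing (𝓞 K) K)ˣ ⧸ (FiniteAdeleRing.unitEmbedding (𝓞 K) K).range) :
    finiteClassGal K α (finiteClassConjGal K f) = finiteClassConjGal K (finiteClassGal K α f) := by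
  induction f using QuotientGroup.induction_on with
  | H y => rw [finiteClassConjGal_mk, finiteClassGal_mk, finiteClassGal_mk, finiteClassConjGal_mk,
      finiteIdeleGal_finiteIdeleConjGal]

/-- **«`τ(f·ιf) = τf·ι(τf)`» and «`τχ(σ) = χ(σ)`» combined**: `α(f)·ι_K(α f) = α (f·ι_K f)` on classes.
[cite: Milne2007FundamentalCM, §4.2 Prop. 4.8 (b)] -/
theorem finiteClassGal_mul_finiteClassConjGal (α : K ≃ₐ[ℚ] K)
    (f : (FiniteAdeleRing (𝓞 K) K)ˣ ⧸ (FiniteAdeleRing.unitEmbedding (𝓞 K) K).range) :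
    finiteClassGal K α f * finiteClassConjGal K (finiteClassGal K α f) = finiteClassGal K α (f * finiteClassConjGal K f) := by
  rw [map_mul, finiteClassGal_finiteClassConjGal]

end CM

/-! ### §5. Proposition 4.8 (b): `f_{Ψτ⁻¹}(σ) = α • f_Ψ(σ)` -/

section Prop48b

variable {K : Type} [Field K] [NumberField K] [IsCMField K] {φ : ℚ →+* ℝ} {c : absoluteGaloisGroup ℚ}
  (hc : IsComplexConjugation φ c) {Ψ : Set (absoluteGaloisGroup ℚ ⧸ (absGaloisRestrict ℚ K).range)}
  (hΨ : IsCMTypeWith c Ψ) {τ : absoluteGaloisGroup ℚ} {α : K ≃ₐ[ℚ] K}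
  (hτ : ∀ x : K, τ • (absEmbedding ℚ K x : AlgebraicClosure ℚ) = absEmbedding ℚ K (α x))
include hc hΨ hτ

/-- **PROPOSITION 4.8 (b) (Milne 2007; Tate): `f_{Ψτ⁻¹}(σ) = α • f_Ψ(σ)`** — «`f_{Φ(τ⁻¹|E)}(σ) = τ f_Φ(σ)` if `τE = E`».
Here `K` is a CM field, `c ∈ Γ_ℚ` a complex conjugation, `Ψ ⊆ Γ_ℚ ⧸ res(Γ_K) = Hom(K, ℚ̄)` a CM type, `τ ∈ Γ_ℚ` maps
`e(K)` onto itself acting there as `α ∈ Aut(K)` (Milne's `τ|E`), `Ψτ⁻¹ = translateType τ Ψ` is Milne's `Φ(τ⁻¹|E)`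
(§2's dictionary), and `α •` = `finiteClassGal K α` on `𝔸^×_{K,f}/K^×`.  PROOF, «similarly» to (a): `α • f_Ψ(σ)`
satisfies the two conditions that determine `f_{Ψτ⁻¹}(σ)` (Prop. 4.6): (a) `[(1, α f), K] = θ_τ^ab [(1,f), K] =
θ_τ^ab(F_Ψ(σ)⁻¹) = F_{Ψτ⁻¹}(σ)⁻¹` (§4 and §3); (b) `αf·ι(αf) = α(f·ιf) = α χ(σ)K^× = χ(σ)K^×` (§4).
[cite: Milne2007FundamentalCM, §4.2 Prop. 4.8 (b)] [cite: Blake2016PlecticTaniyama, §1] -/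
theorem taniyamaElement_translateType (σ : absoluteGaloisGroup ℚ) :
    taniyamaElement K c (translateType τ Ψ) σ = finiteClassGal K α (taniyamaElement K c Ψ σ) := by
  have hΨ' : IsCMTypeWith c (translateType τ Ψ) :=
    isCMTypeWith_translateType hΨ (mem_normalizer_of_smul_absEmbedding K hτ)
  symm
  refine eq_taniyamaElement hc hΨ' ?_ ?_
  · -- (a) `art`
    rw [← absGaloisConjAb_finiteClassArtinMap_of_smul_absEmbedding hτ, finiteClassArtinMap_taniyamaElement hc hΨ,
      map_inv, tateHalfTransfer_translateType hτ hc hΨ σ]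
  · -- (b) `f·ιf = χ(σ)`
    rw [finiteClassGal_mul_finiteClassConjGal, taniyamaElement_mul_finiteClassConjGal hc hΨ σ, finiteClassGal_mk,
      finiteIdeleGal_cyclotomicFiniteIdeleIn]

/-- **Representatives**: if the finite idèle `f` represents `f_Ψ(σ)` then `α f` represents `f_{Ψτ⁻¹}(σ)`.
[cite: Milne2007FundamentalCM, §4.2 Prop. 4.8 (b)] -/
theorem mk_finiteIdeleGal_eq_taniyamaElement_translateType (σ : absoluteGaloisGroup ℚ) {f : (FiniteAdeleRing (𝓞 K) K)ˣ}
    (hf : (QuotientGroup.mk f : (FiniteAdeleRing (𝓞 K) K)ˣ ⧸ (FiniteAdeleRing.unitEmbedding (𝓞 K) K).range) =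
      taniyamaElement K c Ψ σ) :
    (QuotientGroup.mk (finiteIdeleGal K α f) :
        (FiniteAdeleRing (𝓞 K) K)ˣ ⧸ (FiniteAdeleRing.unitEmbedding (𝓞 K) K).range) =
      taniyamaElement K c (translateType τ Ψ) σ := by
  rw [← finiteClassGal_mk, hf, taniyamaElement_translateType hc hΨ hτ]

/-- **(b) together with (a)**: `f_{Ψτ⁻¹}(στ′) = α • (f_{τ′Ψ}(σ) · f_Ψ(τ′))` — both cocycle rules of Prop. 4.8 for the
translated type. [cite: Milne2007FundamentalCM, §4.2 Prop. 4.8 (a), (b)] -/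
theorem taniyamaElement_translateType_mul (σ τ' : absoluteGaloisGroup ℚ) :
    taniyamaElement K c (translateType τ Ψ) (σ * τ') =
      finiteClassGal K α (taniyamaElement K c (τ' • Ψ) σ * taniyamaElement K c Ψ τ') := by
  rw [taniyamaElement_translateType hc hΨ hτ, taniyamaElement_mul hc hΨ]

omit hc hΨ hτ in
/-- `τ ∈ res(Γ_K)` changes nothing: `Ψτ⁻¹ = Ψ` and `f_{Ψτ⁻¹} = f_Ψ`. [cite: Milne2007FundamentalCM, §4.2 Prop. 4.8 (b)] -/
theorem taniyamaElement_translateType_of_mem_range {τ : absoluteGaloisGroup ℚ}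
    (hτH : τ ∈ (absGaloisRestrict ℚ K).range) (σ : absoluteGaloisGroup ℚ) :
    taniyamaElement K c (translateType τ Ψ) σ = taniyamaElement K c Ψ σ := by
  rw [translateType_eq_self_of_mem hτH]

omit hΨ in
/-- **PROP. 4.8 (b) FOR COMPLEX CM TYPES `Φ : CMType K`** read on `Γ_ℚ ⧸ res(Γ_K)` through `j : ℚ̄ → ℂ` (`j ∘ c = conj ∘ j`):
with `Φ′ = Φ(τ⁻¹|E)`, i.e. `s ∈ Φ′ ↔ s ∘ α ∈ Φ` (`Φ′ = cmTypeMap α Φ`), **`f_{Φ′}(σ) = α • f_Φ(σ)`**.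
[cite: Milne2007FundamentalCM, §4.2 Prop. 4.8 (b)] [cite: Deligne1982HodgeCycles, §5 (TeXed re-edition p. 38)] -/
theorem taniyamaElement_preimage_cmType_of_comp {j : AlgebraicClosure ℚ →+* ℂ}
    (hjc : ∀ y : AlgebraicClosure ℚ, j (c • y) = starRingEnd ℂ (j y)) (Φ Φ' : CMType K)
    (hΦ' : ∀ s : K →+* ℂ, s ∈ Φ'.1 ↔ s.comp (α : K →+* K) ∈ Φ.1) (σ : absoluteGaloisGroup ℚ) :
    taniyamaElement K c (embOfCoset K j ⁻¹' Φ'.1) σ =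
      finiteClassGal K α (taniyamaElement K c (embOfCoset K j ⁻¹' Φ.1) σ) := by
  rw [← translateType_preimage_cmType K hτ j Φ Φ' hΦ']
  exact taniyamaElement_translateType hc (isCMTypeWith_preimage_cmType K hc hjc Φ) hτ σ

omit hΨ in
/-- The same at the level of `F`: `F_{Φ′}(σ) = θ_τ^ab (F_Φ(σ))` for `Φ′ = Φ(τ⁻¹|E)`.
[cite: Milne2007FundamentalCM, §4.2 Prop. 4.8 (b)] -/
theorem tateHalfTransfer_preimage_cmType_of_comp {j : AlgebraicClosure ℚ →+* ℂ}
    (hjc : ∀ y : AlgebraicClosure ℚ, j (c • y) = starRingEnd ℂ (j y)) (Φ Φ' : CMType K)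
    (hΦ' : ∀ s : K →+* ℂ, s ∈ Φ'.1 ↔ s.comp (α : K →+* K) ∈ Φ.1) (σ : absoluteGaloisGroup ℚ) :
    tateHalfTransfer K c (embOfCoset K j ⁻¹' Φ'.1) σ =
      absGaloisConjAb hτ (tateHalfTransfer K c (embOfCoset K j ⁻¹' Φ.1) σ) := by
  rw [← translateType_preimage_cmType K hτ j Φ Φ' hΦ']
  exact tateHalfTransfer_translateType hτ hc (isCMTypeWith_preimage_cmType K hc hjc Φ) σ

omit hτ

/-- **THE GALOIS CASE**: for `K/ℚ` Galois EVERY `τ ∈ Γ_ℚ` satisfies «`τE = E`», with `α = τ̄ = absGaloisQuot ℚ K τ`, so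
`f_{Ψτ⁻¹}(σ) = τ̄ • f_Ψ(σ)` for all `σ, τ`. [cite: Milne2007FundamentalCM, §4.2 Prop. 4.8 (b)] -/
theorem taniyamaElement_translateType_of_isGalois [IsGalois ℚ K] (τ σ : absoluteGaloisGroup ℚ) :
    taniyamaElement K c (translateType τ Ψ) σ = finiteClassGal K (absGaloisQuot ℚ K τ) (taniyamaElement K c Ψ σ) :=
  taniyamaElement_translateType hc hΨ (smul_absEmbedding_eq_absGaloisQuot ℚ K τ) σ

omit [IsCMField K] in
/-- The Galois case at the level of `F`: `F_{Ψτ⁻¹}(σ) = θ_τ^ab(F_Ψ(σ))` for every `τ ∈ Γ_ℚ`.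
[cite: Milne2007FundamentalCM, §4.2 Prop. 4.8 (b)] -/
theorem tateHalfTransfer_translateType_of_isGalois [IsGalois ℚ K] (τ σ : absoluteGaloisGroup ℚ) :
    tateHalfTransfer K c (translateType τ Ψ) σ =
      absGaloisConjAb (smul_absEmbedding_eq_absGaloisQuot ℚ K τ) (tateHalfTransfer K c Ψ σ) :=
  tateHalfTransfer_translateType (smul_absEmbedding_eq_absGaloisQuot ℚ K τ) hc hΨ σ

end Prop48b

end Literature.NumberTheory.ComplexMultiplication

end
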